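import Literature.NumberTheory.EllipticCurves.DeShalit1987.EisensteinClassSumInterpolation
import HarnessLib

/-!
# Two bookkeeping inputs of the `j = 0` seam identity: the weights `𝒲 = χ̃⁻¹λ̃^{−m}` are multiplicative at `𝔭`, and the twisted
# Eisenstein class sum does not depend on the system of representatives (de Shalit II.4.14 (38)→(40); proofs only)

Topic `NumberTheory/EllipticCurves/DeShalit1987` (theorems only; no definition, no named fact, no instance).  Sequel of
`EisensteinClassSumInterpolation.lean` (-w7 g13: ★ `sum_twist_eisensteinE_eq_removedEulerFactorsAtZero_mul_continuation`, the twisted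
class sum `Σ_{𝔠∈T} χ̃(𝔠)⁻¹λ̃(𝔠)^{−k}(N𝔞·E_k(Ω, L𝔠) − E_k(Ω, L(𝔞𝔠)))` evaluated by an `L`-value — a quantity that does not mention `T`).
Cell `bsd-print-cf2`, width seat `bsd-line-cf2-p1-w2` g24 (SEAM-ID part 3): the two side hypotheses `h𝒲` and `hST = hST𝔭` of
`Theorems/PrintCf2RubinValueTwoKatzMeasureJZeroSeamIdentity.twist_mul_integral_eq_of_perUnit`, discharged (0 sorry):

* `inv_mul_inv_pow_eq_mul` — **`𝒲(𝔟) = 𝒲(𝔭𝔟)·(χ̃(𝔭)·λ̃(𝔭)^m)`** for `𝒲(𝔟) = χ̃(𝔟)⁻¹·(λ̃(𝔟)^m)⁻¹` (`idealPow_mul`; values non-zero);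
* ★ `sum_twist_eisensteinE_eq_sum_image_mul` — in the setting of the one-stop complex side, for `𝔡 ≠ 0` prime to `𝔪` and class lattices
  supplied on `T`, `𝔞T`, `𝔡T`, `𝔞𝔡T`: **`Σ_{𝔠∈T} 𝒲(𝔠)·(N𝔞·E_k(Ω, L𝔠) − E_k(Ω, L(𝔞𝔠))) = Σ_{𝔠′∈𝔡T} 𝒲(𝔠′)·(N𝔞·E_k(Ω, L𝔠′) − E_k(Ω, L(𝔞𝔠′)))`**
  (`𝔡T` is again a system of representatives, `IsRayClassReps.image_mul`; both sums equal `(k−1)!·Ω^{−k}·(N𝔞 − χ̃λ̃^k(𝔞))·∏(1−η(w))·L(η,0)`)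
  — the reindexing by `𝔭` in de Shalit's (40) without any Euler-factor cancellation.

No summit statement is proved; BSD is not proved by any of this.

## References
* [deShalit1987] E. de Shalit, *Iwasawa theory of elliptic curves with complex multiplication* (1987), II §4.14 (38)–(40) (p. 71–72).
* [NeukirchANT1999] J. Neukirch, *Algebraic Number Theory* (1999), Ch. VI §1 (1.8), Ch. VII §6.
-/

noncomputable section

open scoped nonZeroDivisors Nat
open NumberField NumberField.InfinitePlace IsDedekindDomain Complex
open Literature.NumberTheory.LFunctions Literature.NumberTheory.GaloisRepresentations
open Literature.NumberTheory.GaloisRepresentations.HeckeCharacter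

namespace Literature.NumberTheory.EllipticCurves.DeShalit1987

variable {K : Type} [Field K] [NumberField K]

/-- **The weights are multiplicative at `𝔭`**: for functions `χ̃, λ̃` with non-zero values and non-zero ideals `𝔭, 𝔟`,
`χ̃(𝔟)⁻¹·(λ̃(𝔟)^m)⁻¹ = χ̃(𝔭𝔟)⁻¹·(λ̃(𝔭𝔟)^m)⁻¹ · (χ̃(𝔭)·λ̃(𝔭)^m)` (`idealPow_mul`) — the `h𝒲` of the seam identity with
`w_𝔭 = χ̃(𝔭)λ̃(𝔭)^m`. [cite: NeukirchANT1999, Ch. VII §6 (6.8)] -/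
theorem inv_mul_inv_pow_eq_mul {χ lamv : HeightOneSpectrum (𝓞 K) → ℂ} (hχ : ∀ w, χ w ≠ 0) (hlam : ∀ w, lamv w ≠ 0)
    {𝔭 𝔟 : Ideal (𝓞 K)} (h𝔭 : 𝔭 ≠ ⊥) (h𝔟 : 𝔟 ≠ ⊥) (m : ℕ) :
    (idealPow K χ 𝔟)⁻¹ * (idealPow K lamv 𝔟 ^ m)⁻¹ =
      (idealPow K χ (𝔭 * 𝔟))⁻¹ * (idealPow K lamv (𝔭 * 𝔟) ^ m)⁻¹ * (idealPow K χ 𝔭 * idealPow K lamv 𝔭 ^ m) := by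
  have hχ𝔭 : idealPow K χ 𝔭 ≠ 0 := idealPow_ne_zero hχ 𝔭
  have hl𝔭 : idealPow K lamv 𝔭 ≠ 0 := idealPow_ne_zero hlam 𝔭
  have hχ𝔟 : idealPow K χ 𝔟 ≠ 0 := idealPow_ne_zero hχ 𝔟
  have hl𝔟 : idealPow K lamv 𝔟 ≠ 0 := idealPow_ne_zero hlam 𝔟
  rw [idealPow_mul χ h𝔭 h𝔟, idealPow_mul lamv h𝔭 h𝔟]
  field_simp
  ring

variable [IsTotallyComplex K]

/-- ★ **The twisted Eisenstein class sum does not depend on the representatives: reindexing by an ideal `𝔡` prime to `𝔪`**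
(de Shalit II.4.14 (40): `φ ∘ σ_𝔠 = σ_{𝔠𝔭}` and `𝔠 ↦ 𝔠𝔭` permutes the ray classes): in the setting of
`sum_twist_eisensteinE_eq_removedEulerFactorsAtZero_mul_continuation`, if the class lattices are supplied on `T`, `𝔞T`, `𝔡T` and `𝔞(𝔡T)`, then
`Σ_{𝔠∈T} χ̃(𝔠)⁻¹λ̃(𝔠)^{−k}·(N𝔞·E_k(Ω, L𝔠) − E_k(Ω, L(𝔞𝔠))) = Σ_{𝔠′∈𝔡T} χ̃(𝔠′)⁻¹λ̃(𝔠′)^{−k}·(N𝔞·E_k(Ω, L𝔠′) − E_k(Ω, L(𝔞𝔠′)))` — both equal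
`(k−1)!·Ω^{−k}·(N𝔞 − χ̃(𝔞)λ̃(𝔞)^k)·∏_{w∈Tl}(1 − η(w))·L(η, 0)`. [cite: deShalit1987, II §4.14 (38)–(40) (p. 71–72)]
[cite: NeukirchANT1999, Ch. VI §1 Prop. (1.8)] -/
theorem sum_twist_eisensteinE_eq_sum_image_mul [DecidableEq (Ideal (𝓞 K))] (h2 : Module.finrank ℚ K = 2)
    (w₀ : InfinitePlace K) {lam : HeckeCharacter K} {Tl : Finset (HeightOneSpectrum (𝓞 K))}
    {el : HeightOneSpectrum (𝓞 K) → ℕ} (hl : lam.HasInfinityType (fun _ ↦ 1) (fun _ ↦ 0))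
    (hlmod : IsModulus lam Tl el) (h𝔪1 : modulusIdeal Tl el ≠ ⊤)
    (hw : ∀ u : (𝓞 K)ˣ, (u : 𝓞 K) - 1 ∈ modulusIdeal Tl el → u = 1)
    {χ : HeightOneSpectrum (𝓞 K) → ℂ} (hχ : IsRayClassCharacter (modulusIdeal Tl el) χ)
    {T : Finset (Ideal (𝓞 K))} (hT : IsRayClassReps (modulusIdeal Tl el) T)
    {𝔞 : Ideal (𝓞 K)} (h𝔞 : 𝔞 ≠ ⊥) (h𝔞cop : IsCoprime 𝔞 (modulusIdeal Tl el))
    {𝔡 : Ideal (𝓞 K)} (h𝔡 : 𝔡 ≠ ⊥) (h𝔡cop : IsCoprime 𝔡 (modulusIdeal Tl el))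
    {Ω : ℂ} (hΩ : Ω ≠ 0) (L : Ideal (𝓞 K) → PeriodPair)
    (hL : ∀ 𝔠 ∈ T, ∀ z : ℂ, z ∈ (L 𝔠).lattice ↔
      ∃ x ∈ ((modulusIdeal Tl el : FractionalIdeal (𝓞 K)⁰ K) / (𝔠 : FractionalIdeal (𝓞 K)⁰ K)),
        z = Ω * w₀.embedding x)
    (hL𝔞 : ∀ 𝔠 ∈ T, ∀ z : ℂ, z ∈ (L (𝔞 * 𝔠)).lattice ↔
      ∃ x ∈ ((modulusIdeal Tl el : FractionalIdeal (𝓞 K)⁰ K) /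
        ((𝔞 * 𝔠 : Ideal (𝓞 K)) : FractionalIdeal (𝓞 K)⁰ K)), z = Ω * w₀.embedding x)
    (hL𝔡 : ∀ 𝔠 ∈ T.image (𝔡 * ·), ∀ z : ℂ, z ∈ (L 𝔠).lattice ↔
      ∃ x ∈ ((modulusIdeal Tl el : FractionalIdeal (𝓞 K)⁰ K) / (𝔠 : FractionalIdeal (𝓞 K)⁰ K)),
        z = Ω * w₀.embedding x)
    (hL𝔞𝔡 : ∀ 𝔠 ∈ T.image (𝔡 * ·), ∀ z : ℂ, z ∈ (L (𝔞 * 𝔠)).lattice ↔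
      ∃ x ∈ ((modulusIdeal Tl el : FractionalIdeal (𝓞 K)⁰ K) /
        ((𝔞 * 𝔠 : Ideal (𝓞 K)) : FractionalIdeal (𝓞 K)⁰ K)), z = Ω * w₀.embedding x)
    {η : HeckeCharacter K} {σ' : ℝ} (hη : ∀ x : ideleGroup K, ‖((η x : ℂˣ) : ℂ)‖ = ideleNorm x ^ σ')
    (h1 : 1 < σ') {k : ℕ}
    (hval : ∀ v : HeightOneSpectrum (𝓞 K), ¬ modulusIdeal Tl el ≤ v.asIdeal →
      η.valueAtUniformizer v = (χ v)⁻¹ * (lam.valueAtUniformizer v ^ k)⁻¹)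
    (hram : ∀ v : HeightOneSpectrum (𝓞 K), ¬ η.IsUnramifiedAt v → v ∈ Tl)
    (hLη : LFunction.HasEntireContinuation (heckeLFunction η)) (hk : 3 ≤ k) :
    ∑ 𝔠 ∈ T, (idealPow K χ 𝔠)⁻¹ * (idealPow K (fun v ↦ lam.valueAtUniformizer v) 𝔠 ^ k)⁻¹ *
        ((Ideal.absNorm 𝔞 : ℂ) * (L 𝔠).eisensteinE k Ω - (L (𝔞 * 𝔠)).eisensteinE k Ω) =
      ∑ 𝔠 ∈ T.image (𝔡 * ·), (idealPow K χ 𝔠)⁻¹ * (idealPow K (fun v ↦ lam.valueAtUniformizer v) 𝔠 ^ k)⁻¹ *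
        ((Ideal.absNorm 𝔞 : ℂ) * (L 𝔠).eisensteinE k Ω - (L (𝔞 * 𝔠)).eisensteinE k Ω) := by
  have h𝔪0 : modulusIdeal Tl el ≠ ⊥ := modulusIdeal_ne_bot Tl el
  rw [sum_twist_eisensteinE_eq_removedEulerFactorsAtZero_mul_continuation h2 w₀ hl hlmod h𝔪1 hw hχ hT h𝔞 h𝔞cop hΩ L hL hL𝔞 hη h1 hval
      hram hLη hk,
    sum_twist_eisensteinE_eq_removedEulerFactorsAtZero_mul_continuation h2 w₀ hl hlmod h𝔪1 hw hχ (hT.image_mul h𝔪0 h𝔡 h𝔡cop) h𝔞 h𝔞cop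
      hΩ L hL𝔡 hL𝔞𝔡 hη h1 hval hram hLη hk]

end Literature.NumberTheory.EllipticCurves.DeShalit1987

end
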